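import Literature.MathematicalPhysics.QuantumFieldTheory.Balaban1983to89.B8Prop6DentedCubeMemberGammaRec
import Literature.MathematicalPhysics.QuantumFieldTheory.Balaban1983to89.B8BlockConstantLiftStabilityRec

/-!
# `Balaban1983to89.B8BlockConstantLiftCoverRec` — [Balaban1985RegularSpaces] (1.5)–(1.6), (1.131) ∕ [Balaban1985Variational] (148)–(151): EVERY TRUNCATED CELL OF THE DENTED
# (RECORD) CUBE TOWER LIES UNDER A CELL OF THE FULL DENTED TOWER («dented-top cover»), hence a gauge transformation constant on the block towers under the dented cells keeps
# `Ax` AT EVERY TRUNCATION for the pre-composed Theorem-4 input — item (B′-4), first piece, of the plan's road (B′) for director-ym №310∕№311's branch (ii)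

statement-level skeleton of published theorems with citation tags; proofs where landed; nothing here is a claim about the Yang–Mills mass gap

CITATION HEADER (lean-in-tree rule).  Cell `pub-ymgap` (HUMAN RULING D-0062), «N05-REC» road; director-ym №311 (1)(c′): «(B′-4) crown G4 → G8 by generator LAST» — the dented record
crown's Theorem-4 driver consumes `InAxZ L m (c.lamST m) 1 U₀″` AT EVERY TRUNCATION `m ≤ k` (`B8Prop6DentedCubeMemberGammaRec.inAxZ_lamST_cutFixedZ`, from GLOBAL axiality of `U₀″` on
`□̃`); for the pre-composed input `(U₀″)^{h}` of road (B′) global axiality is lost, and THIS FILE restores the per-truncation statement from constancy of `h` under the FULL dented cells.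
Pen dag-n05-e g41.  [6] = [Balaban1985RegularSpaces] (1.5)–(1.6) p. 77, (1.19)–(1.20) p. 79, (1.131)–(1.133) p. 99; [15] = [Balaban1985Variational] (148)–(151) p. 301; [I] =
[Balaban1987RG1] (0.3) p. 252.  `--kind proof --supports stmt-QuantumFields-20541` (K0⁷; count-neutral; no definition).
REUSED BY NAME: the engine's pure-top cover `B8Prop6DentedCubeMemberGamma.lamST_cover_pure` and dented-carrier readings `Node00.CubeB8D.{mem_lamS_top_iff, mem_lamS_pred_iff, blocks_under,
lamS_of_succ_lt}`, `B8CubeMemberZd.{cubeLamS_top, cubeLamS_of_lt, cubeLamS_self, cubeLam, under_smul_iff}`, `B8Eq131Cubes.{mem_cube_iff, cube_anti, under_flm}`,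
`B8Eq131CubesAdmissible.smul_mem_cube_succ_iff`, `B8Ineq166Univ.under_add_of_under`; the record dictionaries `Node00.CubeB8DZ.{translate, mem_lamS_iff_add_ctrShift}`,
`B8DentedCubeMemberZdRec.mem_lamST_iff_add_ctrShift`, `B8Eq131CubesRecDictionary.underZ_iff_under_add_ctrShift`; (B′-2) `B8BlockConstantLiftStabilityRec.inAxOneZ_gaugeAct_of_blockConstant`;
`B8Eq119TwistedAxialRec.inAxZ_one_iff`; `B8Prop6DentedCubeMemberGammaRec.inAxZ_lamST_cutFixedZ`.

WHAT IS PROVED (sorry-free).  §1 (engine letters, `CubeB8D`) ★★ `lamST_cover_dented` — for `m < k`, every cell `x_j ∈ Λ^{(m)}_j` of the truncated tower (`1 ≤ j ≤ m`) lies under a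
cell `y ∈ Λ′_{j′}` of the FULL dented tower (`j ≤ j′ ≤ k`, `Under L (j′ − j) y x_j`): by the pure-top cover the pure parent is a dented cell unless it is a level-`k` label off the
dented top, in which case (block saturation of `Ω_k`) its level-`(k−1)` children are dent labels and one of them covers `x_j`.  §2 (record letters, `CubeB8DZ`) ★★ `lamST_cover_dented_Z` —
the same for the centred record tower, by translation.  §3 ★★★ `inAxZ_lamST_gaugeAct_of_blockConstant` — for `h` constant on the block tower under every dented cell of level `≥ 1`:
`(∀ m ≤ k, InAxZ L m (c.lamST m) 1 W) → ∀ m ≤ k, InAxZ L m (c.lamST m) 1 (W^{h})`; with `inAxZ_lamST_cutFixedZ` this is `Ax` at every truncation for the pre-composed input `(U₀″)^{h}`.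
HONEST SCOPE.  Lattice∕label bookkeeping of the dented tower + (B′-2)'s covariance; NO estimate; the §1-package twin for `(U₀″)^h` and the G4 → G8 re-assembly are the remaining (B′-4)
pieces; branch (ii) licence line as ruled; `HThm4Rec*` CONDITIONAL; N05 DISCHARGED OF RECORD since R467 (count-neutral record-level work), N07 NOT discharged; counts unmoved (typed 28∕28 ·
discharged 8∕28); one finite 𝕋⁴ programme at fixed ε, `G = SU(2)` of record — nothing continuum ∕ ℝ⁴ ∕ OS ∕ mass gap ∕ Clay.  No `def`, no `instance`, no `notation`, no `sorry`.
-/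

set_option autoImplicit false

noncomputable section

namespace Literature.MathematicalPhysics.QuantumFieldTheory.Balaban1983to89.B8BlockConstantLiftCoverRec

open B7Prop1Explicit hiding Site
open B7Prop1Explicit renaming Site → SiteZ
open B7Prop1Local (InBox)
open BlockAveragingZd (ctrShift)
open B8Ineq132 (Under)
open B8Eq131Cubes (flm cube sqLo sqHi inLo inHi mem_cube_iff cube_anti under_flm)
open B8Eq131CubesAdmissible (smul_mem_cube_succ_iff)
open B8CubeMemberZd (cubeLamS cubeLam cubeLamS_top cubeLamS_of_lt cubeLamS_self under_smul_iff)
open B8Ineq166Univ (under_add_of_under)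
open B8Prop6DentedCubeMemberGamma (lamST_cover_pure)
open B8Eq119TwistedAxialRec (UnderZ InAxZ InAxOneZ inAxZ_one_iff)
open B8Eq131CubesRecDictionary (underZ_iff_under_add_ctrShift)
open B8DentedCubeMemberZdRec (mem_lamST_iff_add_ctrShift)
open B8BlockConstantLiftStabilityRec (inAxOneZ_gaugeAct_of_blockConstant)
open Node00 (CubeB8D CubeB8DZ)

variable {d : ℕ}

/-! ## §1  The dented-top cover (engine letters) -/

section Engine

variable {L K : ℕ} {Ω : ℕ → Set (SiteZ d)}

/-- The floor map inverts `Under`: `z ∈ Bᵐ(x) ⇒ ⌊z∕Lᵐ⌋ = x`. [folklore] -/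
private theorem flm_eq_of_under {L : ℕ} (hL : 1 ≤ L) {m : ℕ} {x z : SiteZ d} (hz : Under L m x z) : flm L m z = x := by
  funext i
  obtain ⟨h1, h2⟩ := hz i
  have hL0 : (0 : ℤ) < (L : ℤ) := by exact_mod_cast hL
  have hpos : (0 : ℤ) < (L : ℤ) ^ m := pow_pos hL0 m
  simp only [flm]
  have hlo : x i ≤ z i / (L : ℤ) ^ m := Int.le_ediv_of_mul_le hpos (by linarith)
  have hhi : z i / (L : ℤ) ^ m < x i + 1 := Int.ediv_lt_of_lt_mul hpos (by linarith)
  omega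

/-- `z ∈ B⁰(x) ↔ z = x` in `Under` letters. [folklore] -/
private theorem under_zero_self (L : ℕ) (x : SiteZ d) : Under L 0 x x := by
  intro i; simp

/-- ★★ **THE DENTED-TOP COVER** (engine letters): for a dented cube datum `c` and a truncation `m < k`, every cell `x_j ∈ Λ^{(m)}_j` (`c.lamST m j`, `1 ≤ j ≤ m`) lies under some cell
`y ∈ Λ′_{j′}` of the FULL dented tower (`c.lamS j′`, `j ≤ j′ ≤ k`): `Under L (j′ − j) y x_j`.  The pure-top cover gives a pure cell `y` of level `j′`; for `j′ ≤ k − 1` it is a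
dented cell (annulus cells coincide; at level `k − 1` the dent clause is void off the footprint of `□_k`); for `j′ = k` either `y`'s `k`-block lies in `Ω_k` (`y ∈ Λ′_k`) or, by the
block saturation of `Ω_k`, NO fine site under `y` lies in `Ω_k`, so the level-`(k−1)` ancestor of `x_j` is a dent label (`∈ Λ′_{k−1}`).
[cite: Balaban1985RegularSpaces, (1.5)–(1.6) p.77, (1.131) p.99; Balaban1985Variational, (148)–(151) p.301; Balaban1987RG1, (0.3) p.252] -/
theorem lamST_cover_dented (hL : 1 ≤ L) (c : CubeB8D d L K Ω) {m : ℕ} (hm : m < c.k) :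
    ∀ j, 1 ≤ j → j ≤ m → ∀ xj ∈ c.lamST m j, ∃ j', j ≤ j' ∧ j' ≤ c.k ∧ ∃ y ∈ c.lamS j', Under L (j' - j) y xj := by
  intro j hj1 hjm xj hxj
  obtain ⟨j', hjj', hj'k, y, hy, hU⟩ := lamST_cover_pure c hL m hm.le j hj1 hjm xj hxj
  rcases Nat.lt_or_ge (j' + 1) c.k with hlt | hge
  · -- `j′ + 1 < k`: annulus cells coincide
    refine ⟨j', hjj', hj'k, y, ?_, hU⟩
    rw [c.lamS_of_succ_lt hlt]
    have hy' : y ∈ cubeLam L c.a c.M c.ρ c.k j' := by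
      have h := hy; rw [cubeLamS_top L c.a c.M c.ρ hj'k] at h; exact h
    exact hy'
  · rcases Nat.lt_or_ge j' c.k with hlt' | hge'
    · -- `j′ = k − 1`: the pure cell is off the footprint of `□_k`, so the dent clause is void
      have hj' : j' = c.k - 1 := by omega
      subst hj'
      refine ⟨c.k - 1, hjj', hj'k, y, ?_, hU⟩
      have hy' : y ∈ cubeLam L c.a c.M c.ρ c.k (c.k - 1) := by
        have h := hy; rw [cubeLamS_top L c.a c.M c.ρ hj'k] at h; exact h
      obtain ⟨hsq, hnin⟩ := hy'
      rw [c.mem_lamS_pred_iff]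
      exact ⟨hsq, fun h => hnin hlt' h.1⟩
    · -- `j′ = k`
      have hj' : j' = c.k := le_antisymm hj'k hge'
      subst hj'
      have hy' : InBox (sqLo L c.a c.ρ c.k c.k) (sqHi L c.a c.M c.ρ c.k c.k) y := by
        have h := hy; rw [cubeLamS_top L c.a c.M c.ρ le_rfl] at h; exact h.1
      by_cases htop : c.inTop y
      · exact ⟨c.k, hjj', le_rfl, y, (c.mem_lamS_top_iff y).2 ⟨hy', htop⟩, hU⟩
      · -- the level-`(k−1)` ancestor of `x_j` is a dent label
        have hjk : j ≤ c.k - 1 := by omega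
        set z' : SiteZ d := flm L (c.k - 1 - j) xj with hz'
        have hz'x : Under L (c.k - 1 - j) z' xj := under_flm hL _ xj
        -- `z′` lies one level under `y`
        have hyz' : Under L 1 y z' := by
          have h1 : flm L 1 z' = y := by
            have := flm_eq_of_under hL hU
            -- `⌊⌊x∕L^{k−1−j}⌋∕L⌋ = ⌊x∕L^{k−j}⌋`
            funext i
            have hL0 : (0 : ℤ) < (L : ℤ) := by exact_mod_cast hL
            have hcomp : flm L 1 z' i = flm L (c.k - j) xj i := by
              simp only [flm, hz', pow_one]
              rw [Int.ediv_ediv_of_nonneg (le_of_lt (pow_pos hL0 _)), ← pow_succ,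
                show c.k - 1 - j + 1 = c.k - j by omega]
            rw [hcomp, this]
          rw [← h1]; exact under_flm hL 1 z'
        refine ⟨c.k - 1, hjk, Nat.sub_le _ _, z', ?_, hz'x⟩
        rw [c.mem_lamS_pred_iff]
        -- `L^{k−1}·z′` lies in `□_k` (under `y`), hence `z′` is in the footprint box and in `□_{k−1}`'s label box
        have hsm : ((L : ℤ) ^ (c.k - 1)) • z' ∈ cube L c.a c.M c.ρ c.k c.k := by
          refine (mem_cube_iff hL).2 ⟨y, hy', ?_⟩
          have := (under_smul_iff hL 1 (c.k - 1) y z').2 hyz'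
          rwa [show 1 + (c.k - 1) = c.k by omega] at this
        have hin : InBox (inLo L c.a c.ρ c.k (c.k - 1)) (inHi L c.a c.M c.ρ c.k (c.k - 1)) z' := by
          have h := (smul_mem_cube_succ_iff hL c.a c.M c.ρ (by omega : c.k - 1 < c.k) z').1
          rw [show c.k - 1 + 1 = c.k by omega] at h
          exact h hsm
        have hzz : Under L (c.k - 1) z' (((L : ℤ) ^ (c.k - 1)) • z') := by
          simpa using (under_smul_iff hL 0 (c.k - 1) z' z').2 (under_zero_self L z')
        have hsq : InBox (sqLo L c.a c.ρ c.k (c.k - 1)) (sqHi L c.a c.M c.ρ c.k (c.k - 1)) z' := by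
          have hsm' : ((L : ℤ) ^ (c.k - 1)) • z' ∈ cube L c.a c.M c.ρ c.k (c.k - 1) :=
            cube_anti (Nat.sub_le _ _) le_rfl hsm
          obtain ⟨w, hw, hwU⟩ := (mem_cube_iff hL).1 hsm'
          have hwz : w = z' := by
            have := flm_eq_of_under hL hwU
            have h0 : flm L (c.k - 1) (((L : ℤ) ^ (c.k - 1)) • z') = z' := flm_eq_of_under hL hzz
            rw [h0] at this; exact this.symm
          rwa [hwz] at hw
        refine ⟨hsq, fun ⟨_, hall⟩ => htop ?_⟩
        -- if the whole `(k−1)`-block of `z′` were in `Ω_k`, saturation would put `y`'s `k`-block in `Ω_k`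
        have hx0 : ((L : ℤ) ^ (c.k - 1)) • z' ∈ Ω c.k := hall _ hzz
        have hflm : flm L c.k (((L : ℤ) ^ (c.k - 1)) • z') = y := by
          refine flm_eq_of_under hL ?_
          have := (under_smul_iff hL 1 (c.k - 1) y z').2 hyz'
          rwa [show 1 + (c.k - 1) = c.k by omega] at this
        intro w hw
        refine c.blocks_under hL hx0 ?_
        rwa [hflm]

end Engine

/-! ## §2  The dented-top cover for the centred RECORD tower, by translation -/

section Record

variable {L K : ℕ} {Ω : ℕ → Set (SiteZ d)}

/-- ★★ **THE DENTED-TOP COVER, RECORD TOWER** (odd `L`): for `m < k`, every record truncated cell `x_j ∈ c.lamST m j` (`1 ≤ j ≤ m`) lies under a full dented record cell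
`y ∈ c.lamS j′`, `j ≤ j′ ≤ k`: `UnderZ L (j′ − j) y x_j` — §1 on the translated datum `c.translate` and the dictionaries `mem_lamST_iff_add_ctrShift`, `mem_lamS_iff_add_ctrShift`,
`underZ_iff_under_add_ctrShift`. [cite: Balaban1985RegularSpaces, (1.5)–(1.6) p.77, (1.131) p.99; Balaban1985Variational, (148)–(151) p.301; Balaban1987RG1, (0.3) p.252] -/
theorem lamST_cover_dented_Z (hLo : Odd L) (c : CubeB8DZ d L K Ω) {m : ℕ} (hm : m < c.k) :
    ∀ j, 1 ≤ j → j ≤ m → ∀ xj ∈ c.lamST m j, ∃ j', j ≤ j' ∧ j' ≤ c.k ∧ ∃ y ∈ c.lamS j', UnderZ L (j' - j) y xj := by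
  intro j hj1 hjm xj hxj
  have hL : 1 ≤ L := hLo.pos
  have hxj' := (mem_lamST_iff_add_ctrShift c hLo m j xj).1 hxj
  obtain ⟨j', hjj', hj'k, y', hy', hU'⟩ := lamST_cover_dented hL (c.translate hLo) (by simpa using hm) j hj1 hjm _ hxj'
  have hj'k' : j' ≤ c.k := by simpa using hj'k
  refine ⟨j', hjj', hj'k', y' - (fun _ => (ctrShift L (c.k - j') : ℤ)), ?_, ?_⟩
  · rw [c.mem_lamS_iff_add_ctrShift hLo j', sub_add_cancel]
    exact hy'
  · rw [underZ_iff_under_add_ctrShift hLo (show j' - j ≤ c.k - j by omega)]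
    have e : c.k - j - (j' - j) = c.k - j' := by omega
    rw [e, sub_add_cancel]
    exact hU'

/-! ## §3  `Ax` at every truncation survives the pre-composition by a transformation constant under the dented cells -/

/-- ★★★ **`Ax` AT EVERY TRUNCATION FOR THE PRE-COMPOSED INPUT** (record tower, odd `L`): let `h` be constant on the block tower under every dented cell `y ∈ c.lamS j′`, `1 ≤ j′ ≤ k`
(`h x = X(j′, y)` for `UnderZ L j′ y x`).  Then `h` is constant under every TRUNCATED cell of level `≥ 1` (§2), so (B′-2) applies at each truncation:
`(∀ m ≤ k, InAxZ L m (c.lamST m) 1 W) → ∀ m ≤ k, InAxZ L m (c.lamST m) 1 (W^{h})` — with `B8Prop6DentedCubeMemberGammaRec.inAxZ_lamST_cutFixedZ` (`W = U₀″`) this is the `Ax`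
conjunct of Theorem 4's hypotheses for `(U₀″)^{h}` on the dented record tower. [cite: Balaban1985RegularSpaces, (1.19)–(1.20) p.79, (1.132) p.99; Balaban1985Variational, (151) p.301; Balaban1987RG1, (0.6) p.253] -/
theorem inAxZ_lamST_gaugeAct_of_blockConstant (hLo : Odd L) (c : CubeB8DZ d L K Ω)
    {𝔸 : Type*} [NormedRing 𝔸] [NormedAlgebra ℂ 𝔸] [CompleteSpace 𝔸]
    (h : SiteZ d → 𝔸ˣ) (X : ℕ → SiteZ d → 𝔸ˣ)
    (hconst : ∀ j, 1 ≤ j → j ≤ c.k → ∀ y ∈ c.lamS j, ∀ x, UnderZ L j y x → h x = X j y)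
    {W : SiteZ d → Fin d → 𝔸ˣ} (hW : ∀ m, m ≤ c.k → InAxZ L m (c.lamST m) (1 : SiteZ d → Fin d → 𝔸ˣ) W) :
    ∀ m, m ≤ c.k → InAxZ L m (c.lamST m) (1 : SiteZ d → Fin d → 𝔸ˣ) (gaugeAct h W) := by
  intro m hm
  rw [inAxZ_one_iff]
  have hWm : InAxOneZ L m (c.lamST m) W := (inAxZ_one_iff L m (c.lamST m) W).1 (hW m hm)
  -- constancy under the truncated cells, with the datum read off the centre of each tower
  refine inAxOneZ_gaugeAct_of_blockConstant hLo m (c.lamST m) (fun j xj => h (((L : ℤ) ^ j) • xj)) h ?_ hWm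
  intro j hj1 hjm xj hxj x hx
  -- both `x` and the centre `Lʲ·x_j` lie under the covering dented cell
  rcases Nat.lt_or_ge m c.k with hmk | hmk
  · obtain ⟨j', hjj', hj'k, y, hy, hU⟩ := lamST_cover_dented_Z hLo c hmk j hj1 hjm xj hxj
    have hj'1 : 1 ≤ j' := hj1.trans hjj'
    have e1 : j' - j + j = j' := by omega
    have hx' : UnderZ L j' y x := by
      have := B8BlockConstantLiftStabilityRec.underZ_add hLo hU hx; rwa [e1] at this
    have hc' : UnderZ L j' y (((L : ℤ) ^ j) • xj) := by
      have := B8BlockConstantLiftStabilityRec.underZ_add hLo hU (B8BlockConstantLiftStabilityRec.underZ_pow_smul L j xj); rwa [e1] at this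
    rw [hconst j' hj'1 hj'k y hy x hx', hconst j' hj'1 hj'k y hy _ hc']
  · -- `m = k`: the truncated cells ARE the dented cells
    have hmk' : m = c.k := le_antisymm hm hmk
    subst hmk'
    rw [B8DentedCubeMemberZdRec.lamST_top_apply] at hxj
    have hjk : j ≤ c.k := hjm
    rw [hconst j hj1 hjk xj hxj x hx, hconst j hj1 hjk xj hxj _ (B8BlockConstantLiftStabilityRec.underZ_pow_smul L j xj)]

end Record

end Literature.MathematicalPhysics.QuantumFieldTheory.Balaban1983to89.B8BlockConstantLiftCoverRec
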